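import Summits.RiemannHypothesis.RiemannHypothesis.Theorems.ZetaStringSemilocalKernel
import Summits.RiemannHypothesis.RiemannHypothesis.Theorems.HandoffMarginRung
import HarnessLib

/-!
# Suzuki's (1.5) is EXACTLY a Weil rung: `G ≽ 0 on (−a, a) ↔ WeilPositivityOn a` (full form; RH-FREE glue)

LINE 1 — LABEL: RH-FREE glue; no positivity of `ζ`'s Weil form or of Suzuki's kernel is asserted; the `∀ a` statement
is Suzuki 2023 Thm 1.2 / Weil's criterion (RH-EQUIVALENT, `riemannHypothesis_iff_forall_isPosSemidefKernelOn_zetaScrewKernel`,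
labelled and NOT claimed). bears_on: LADDER-RH B-C/B-D (cell rh-dbr: the rung ↔ depth dictionary of ENGINE-TARGETS §3.1 for
the FULL form; routes PluckedString `ScrewToWeilOn`/`ScrewConverse`, DeBrangesShift). WHAT THIS IS NOT: progress toward RH.

The tree held the two directions on DIFFERENT windows: `KernelOfWeilOn.isPosSemidefKernelOn_zetaScrewKernel_of_weilPositivityOn`
(`WeilPositivityOn a →` kernel PSD on the OPEN `(−a, a)`, eng-5 g3) and `screwToWeilOn_proof` (kernel PSD on the CLOSED `[−a, a]`
`→ WeilPositivityOn a`). This file closes the gap: for every real `a`,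

`IsPosSemidefKernelOn G (Ioo (−a) a) ↔ WeilPositivityOn a` (`isPosSemidefKernelOn_zetaScrewKernel_iff_weilPositivityOn`),

i.e. Suzuki's `−Ψ|_{(−2a,2a)} ∈ 𝒢_a` ((1.5)) is literally Weil positivity on `C(a)`. Proof: on the window `|v| < 2a ≤ log q`
(`q = ⌈e^{2a}⌉₊`) Suzuki's `Ψ` coincides with the `S`-truncated screw function `Ψ_S`, `S = {primes < q}`
(`zetaScrew_eq_semilocalScrew_of_abs_lt_log`), so the kernels agree on `(−a,a)²`; the general-`S` dictionary
`isPosSemidefKernelOn_semilocalKernel_iff` (sibling `ZetaStringSemilocalKernel`, whose ⟹ direction uses Column WEIL's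
closedness `weilSemilocalPositivityOn_of_forall_lt`) and the locality `HandoffMarginRung.weilSemilocalPositivityOn_primesBelow_iff`
(`Q_S = Q` on `C(a)` for `a ≤ (log q)/2`) conclude.

References: M. Suzuki, J. Lond. Math. Soc. (2) 108 (2023) = arXiv:2206.03682, (1.4)–(1.5), Thm 1.2, Prop. 3.1; H. Yoshida,
Adv. Stud. Pure Math. 21 (1992) Prop. 6, Lemma 7; A. Connes, C. Consani, Enseign. Math. 69 (2023) §2.1.2.
-/

-- `Summit.RiemannHypothesis.RiemannHypothesis.…` duplicates `RiemannHypothesis` BY DESIGN (D-0017).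
set_option linter.dupNamespace false

noncomputable section

open MeasureTheory Set Filter
open scoped BigOperators ComplexConjugate

namespace Summit.RiemannHypothesis.RiemannHypothesis.Theorems.ZetaStringArchWall

open Literature.NumberTheory.LFunctions Literature.Analysis.Complex
open Summit.RiemannHypothesis.RiemannHypothesis.Theorems.HandoffMarginRung (weilSemilocalPositivityOn_primesBelow_iff)
open Summit.RiemannHypothesis.RiemannHypothesis.Theorems.MotivicDoor.Semilocal (primeFactors_subset_primesBelow)

variable {a : ℝ}

/-! ## §1 Kernels that agree on the window have the same positivity there -/

/-- Two kernels that agree on `A × A` are positive semidefinite on `A` together. [folklore] -/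
theorem isPosSemidefKernelOn_congr {α : Type*} {K K' : α → α → ℂ} {A : Set α}
    (h : ∀ t ∈ A, ∀ u ∈ A, K t u = K' t u) :
    IsPosSemidefKernelOn K A ↔ IsPosSemidefKernelOn K' A := by
  constructor <;> intro hK N x hx c
  · have e : ∀ i j, K' (x i) (x j) = K (x i) (x j) := fun i j => (h _ (hx i) _ (hx j)).symm
    simp only [e]; exact hK N x hx c
  · have e : ∀ i j, K (x i) (x j) = K' (x i) (x j) := fun i j => h _ (hx i) _ (hx j)
    simp only [e]; exact hK N x hx c

/-! ## §2 On `|v| < log q` Suzuki's `Ψ` is the `{p < q}`-truncated screw function -/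

/-- Below `log q` every visible prime power is `{p < q}`-smooth, so `Ψ(v) = Ψ_S(v)` for `S = Nat.primesBelow q`:
`Ψ = Ψ_∅ − φ` and the full prime sum `φ` has the coefficients `Λ(n) n^{-1/2} = weilSemilocalCoeff S n` for all
`n ≤ e^{|v|} < q`. [cite: Suzuki2023, (1.1)] -/
theorem zetaScrew_eq_semilocalScrew_of_abs_lt_log {q : ℕ} {Ψq : ℝ → ℝ}
    (hΨ : ∀ v, Ψq v = archScrew v -
      ∑ n ∈ Finset.Icc 1 ⌊Real.exp |v|⌋₊, weilSemilocalCoeff (Nat.primesBelow q) n * (|v| - Real.log n))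
    {v : ℝ} (hv : |v| < Real.log q) : zetaScrew v = Ψq v := by
  have hq0 : 0 < q := by
    rcases Nat.eq_zero_or_pos q with h | h
    · subst h; simp at hv; linarith [abs_nonneg v]
    · exact h
  have hqR : (0 : ℝ) < q := by exact_mod_cast hq0
  have hlt : Real.exp |v| < q := by rwa [← Real.lt_log_iff_exp_lt hqR]
  have hfloor : ⌊Real.exp |v|⌋₊ ≤ q - 1 := by
    have h1 : ⌊Real.exp |v|⌋₊ < q := (Nat.floor_lt (Real.exp_pos _).le).2 hlt
    omega
  rw [hΨ, archScrew, zetaScrewPrimeSum]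
  have hcoef : ∀ n ∈ Finset.Icc 1 ⌊Real.exp |v|⌋₊,
      weilSemilocalCoeff (Nat.primesBelow q) n * (|v| - Real.log n) =
        ArithmeticFunction.vonMangoldt n / Real.sqrt n * (|v| - Real.log n) := by
    intro n hn
    have hn' : n ≤ q - 1 := (Finset.mem_Icc.1 hn).2.trans hfloor
    have hS : ∀ m ≤ q - 1, IsPrimePow m → m.primeFactors ⊆ Nat.primesBelow q := fun m hm _ => by
      have h := primeFactors_subset_primesBelow hm
      rwa [Nat.sub_add_cancel hq0] at h
    rw [weilSemilocalCoeff_eq_of_forall hS hn']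
  rw [Finset.sum_congr rfl hcoef]
  ring

/-! ## §3 The exact dictionary for the full form -/

/-- **Suzuki's (1.5) ⟺ the Weil rung on the same window.** For every real `a`: Suzuki's kernel
`G(t,u) = Ψ(t) + Ψ(u) − Ψ(t−u)` is positive semidefinite on finite configurations in the OPEN window `(−a, a)` iff Weil's
quadratic functional is non-negative on smooth `g` supported in `[−a, a]`. (Both directions were in the tree on different
windows — open for ⟸, closed for ⟹; the gap is closed by Column WEIL's closedness of the positive windows, through the
`S`-truncated dictionary with `S = {p < ⌈e^{2a}⌉}`, on whose window `Ψ_S = Ψ`.) RH-FREE glue; nothing here bears on RH.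
[cite: Suzuki2023, (1.4)–(1.5) and Prop 3.1] -/
theorem isPosSemidefKernelOn_zetaScrewKernel_iff_weilPositivityOn (a : ℝ) :
    IsPosSemidefKernelOn (fun t u : ℝ => (zetaScrewKernel t u : ℂ)) (Ioo (-a) a) ↔ WeilPositivityOn a := by
  by_cases ha : 0 < a
  swap
  · have hW : WeilPositivityOn a :=
      weilPositivityOn_of_le_log_two_half ((not_lt.1 ha).trans (div_nonneg (Real.log_nonneg one_le_two) zero_le_two))
    refine ⟨fun _ => hW, fun _ => ?_⟩
    intro N t ht c
    rcases Nat.eq_zero_or_pos N with hN | hN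
    · subst hN; simp
    · exact absurd (ht ⟨0, hN⟩) fun h => ha (by linarith [h.1, h.2])
  -- the comparison prime bound `q = ⌈e^{2a}⌉`
  set q : ℕ := ⌈Real.exp (2 * a)⌉₊ with hqdef
  have hq : Real.exp (2 * a) ≤ q := Nat.le_ceil _
  have hqR : (0 : ℝ) < q := (Real.exp_pos _).trans_le hq
  have h1q : 1 ≤ q := by exact_mod_cast (show (0 : ℕ) < q by exact_mod_cast hqR)
  have h2a : 2 * a ≤ Real.log q := by rwa [Real.le_log_iff_exp_le hqR]
  set Ψq : ℝ → ℝ := fun v => archScrew v -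
    ∑ n ∈ Finset.Icc 1 ⌊Real.exp |v|⌋₊, weilSemilocalCoeff (Nat.primesBelow q) n * (|v| - Real.log n) with hΨqdef
  have hΨ : ∀ v, Ψq v = archScrew v -
      ∑ n ∈ Finset.Icc 1 ⌊Real.exp |v|⌋₊, weilSemilocalCoeff (Nat.primesBelow q) n * (|v| - Real.log n) :=
    fun v => rfl
  -- on the window the two kernels agree
  have hcongr : ∀ t ∈ Ioo (-a) a, ∀ u ∈ Ioo (-a) a, (zetaScrewKernel t u : ℂ) = kreinKernel Ψq t u := by
    intro t ht u hu
    have hta : |t| < a := abs_lt.2 ⟨ht.1, ht.2⟩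
    have hua : |u| < a := abs_lt.2 ⟨hu.1, hu.2⟩
    have htu : |t - u| < 2 * a := abs_sub_lt_iff.2 ⟨by linarith [ht.2, hu.1], by linarith [ht.1, hu.2]⟩
    have h1 : |t| < Real.log q := by linarith
    have h2 : |u| < Real.log q := by linarith
    have h3 : |t - u| < Real.log q := by linarith
    simp only [zetaScrewKernel, kreinKernel, zetaScrew_eq_semilocalScrew_of_abs_lt_log hΨ h1,
      zetaScrew_eq_semilocalScrew_of_abs_lt_log hΨ h2, zetaScrew_eq_semilocalScrew_of_abs_lt_log hΨ h3]
  rw [isPosSemidefKernelOn_congr hcongr, isPosSemidefKernelOn_semilocalKernel_iff hΨ,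
    weilSemilocalPositivityOn_primesBelow_iff h1q (by linarith)]

/-- One-sided window form: `WeilPositivityOn a ↔ G ≽ 0` on finite configurations in `(0, 2a)` (Suzuki's `𝒢_a`
membership in the screw-line coordinate of ENGINE-TARGETS §3.1, «ℓ = 2a»). [cite: Suzuki2023, (1.5)] -/
theorem weilPositivityOn_iff_isPosSemidefKernelOn_Ioo_zero (a : ℝ) :
    WeilPositivityOn a ↔ IsPosSemidefKernelOn (fun t u : ℝ => (zetaScrewKernel t u : ℂ)) (Ioo 0 (2 * a)) := by
  rw [← isPosSemidefKernelOn_zetaScrewKernel_symm_iff, isPosSemidefKernelOn_zetaScrewKernel_iff_weilPositivityOn]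

/-- Real-form version (the language of route PluckedString's `ScrewToWeilOn` / `ScrewConverse`, OPEN window):
`WeilPositivityOn a ↔ Σᵢⱼ (Ψ(tᵢ) + Ψ(tⱼ) − Ψ(tᵢ − tⱼ)) xᵢ xⱼ ≥ 0` for all finite real configurations with `|tᵢ| < a`.
[cite: Suzuki2023, (1.4)–(1.5)] -/
theorem weilPositivityOn_iff_sum_sum_zetaScrewKernel_nonneg (a : ℝ) :
    WeilPositivityOn a ↔ ∀ (N : ℕ) (t x : Fin N → ℝ), (∀ i, |t i| < a) →
      0 ≤ ∑ i, ∑ j, zetaScrewKernel (t i) (t j) * (x i * x j) := by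
  rw [← isPosSemidefKernelOn_zetaScrewKernel_iff_weilPositivityOn, isPosSemidefKernelOn_zetaScrewKernel_iff]
  refine forall₃_congr fun N t x => ?_
  have e : (∀ i, t i ∈ Ioo (-a) a) ↔ ∀ i, |t i| < a :=
    forall_congr' fun i => by rw [mem_Ioo, abs_lt]
  rw [e]

/-- RH-EQUIVALENT (labelled; NOT claimed): RH iff Suzuki's kernel is positive semidefinite on finite configurations in
every window `(−a, a)` — Weil's criterion (`riemannHypothesis_iff_forall_weilPositivityOn`) in the Kreĭn-kernel
coordinate; Suzuki 2023 Thm 1.2 on open windows. [cite: Suzuki2023, Thm 1.2] -/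
theorem riemannHypothesis_iff_forall_isPosSemidefKernelOn_zetaScrewKernel :
    _root_.RiemannHypothesis ↔ ∀ a : ℝ, 0 < a →
      IsPosSemidefKernelOn (fun t u : ℝ => (zetaScrewKernel t u : ℂ)) (Ioo (-a) a) := by
  rw [riemannHypothesis_iff_forall_weilPositivityOn]
  exact forall₂_congr fun a _ => (isPosSemidefKernelOn_zetaScrewKernel_iff_weilPositivityOn a).symm

end Summit.RiemannHypothesis.RiemannHypothesis.Theorems.ZetaStringArchWall

end
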